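import Mathlib.Order.DirectedInverseSystem
import Mathlib.Data.Finset.Order
import Mathlib.Topology.ContinuousMap.Basic
import Mathlib.Topology.Bases
import Mathlib.Topology.Connected.Basic
import Mathlib.Topology.Compactness.LocallyCompact
import Mathlib.Topology.Separation.Hausdorff
import Mathlib.Topology.Homeomorph.Lemmas
import HarnessLib

/-!
# The topology of a direct limit of spaces along open embeddings

For a directed system of topological spaces `F i` (`i` in a directed preorder `ι`) with continuous
transition maps `f i j h : C(F i, F j)` (`i ≤ j`) which are **injective and open** — a directed
system of open embeddings — Mathlib's direct limit `DirectLimit F f` (the quotient of `Σ i, F i`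
identifying `x ∈ F i` with `f i j h x`; `Mathlib.Order.DirectedInverseSystem`) carries the quotient
of the sum topology, and the canonical maps `x ↦ ⟦⟨i, x⟩⟧` are then open embeddings whose images
are directed and cover. Consequently the limit is Hausdorff, (pre)connected and weakly locally
compact when the pieces are, every compact subset lies in one piece, and the limit is second
countable as soon as countably many pieces are cofinal. (Bourbaki, *General Topology*, Ch. I,
§2, no. 4, final topologies, Prop. 6 and Example; Dugundji, *Topology*, VI.8; for the smooth case,
the union `K̃` of a totally ordered family of developments in Choquet-Bruhat–Geroch,
Comm. Math. Phys. 14 (1969), p. 333.)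

This is the topological layer of the union-of-a-chain construction of developments in the existence
proof of the maximal globally hyperbolic development
(`Literature.Geometry.Lorentzian.CauchyProblemMGHDExistenceProofs`, § "What remains", item (a)).
The canonical map is written `fun x : F i ↦ (⟦⟨i, x⟩⟧ : DirectLimit F f)` throughout (no new
definition is introduced):

* `continuous_directLimitMk`, `directLimitMk_eq_iff`, `preimage_image_directLimitMk`,
  `isOpenMap_directLimitMk`, `isOpenEmbedding_directLimitMk`, `isOpen_range_directLimitMk`
  (injectivity of the canonical maps along injective transition maps is Mathlib's
  `DirectLimit.mk_injective`, used directly);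
* `range_directLimitMk_mono`, `iUnion_range_directLimitMk`,
  `exists_subset_range_directLimitMk_of_isCompact`;
* `t2Space_directLimit`, `preconnectedSpace_directLimit`, `connectedSpace_directLimit`,
  `weaklyLocallyCompactSpace_directLimit`, `secondCountableTopology_directLimit_of_cofinal`.

## References

* N. Bourbaki, *General Topology, Chapters 1–4*, Springer 1989, Ch. I, §2 no. 4 (final
  topologies), §8–§11. [BourbakiGT1]
* Y. Choquet-Bruhat, R. Geroch, Comm. Math. Phys. 14 (1969) 329–335, p. 333 (the manifold `K̃`,
  union of a totally ordered family of developments). [ChoquetBruhatGeroch1969CMP]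
-/

namespace Literature.Topology

open Set Filter Function _root_.Topology TopologicalSpace

variable {ι : Type*} [Preorder ι] [IsDirectedOrder ι] {F : ι → Type*} [∀ i, TopologicalSpace (F i)]
  (f : ∀ i j, i ≤ j → C(F i, F j)) [DirectedSystem F (f · · ·)]

/-- The canonical map `F i → lim F` is continuous (composite of `Sigma.mk` and the quotient map).
[cite: BourbakiGT1, Ch. I §2 no. 4] -/
theorem continuous_directLimitMk (i : ι) :
    Continuous fun x : F i ↦ (⟦⟨i, x⟩⟧ : DirectLimit F f) :=
  continuous_quotient_mk'.comp continuous_sigmaMk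

/-- Two points have the same image in the limit iff they agree in some later piece.
[cite: BourbakiGT1, Ch. I §2 no. 4] -/
theorem directLimitMk_eq_iff {i j : ι} {x : F i} {y : F j} :
    (⟦⟨i, x⟩⟧ : DirectLimit F f) = ⟦⟨j, y⟩⟧ ↔
      ∃ (k : ι) (hik : i ≤ k) (hjk : j ≤ k), f i k hik x = f j k hjk y :=
  Quotient.eq

/-- The trace on the piece `F j` of the image of `U ⊆ F i` in the limit:
`mk_j⁻¹(mk_i(U)) = ⋃_{k ≥ i, j} f_{jk}⁻¹(f_{ik}(U))`. [cite: BourbakiGT1, Ch. I §2 no. 4] -/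
theorem preimage_image_directLimitMk (i j : ι) (U : Set (F i)) :
    (fun y : F j ↦ (⟦⟨j, y⟩⟧ : DirectLimit F f)) ⁻¹'
        ((fun x : F i ↦ (⟦⟨i, x⟩⟧ : DirectLimit F f)) '' U) =
      ⋃ (k : ι) (hik : i ≤ k) (hjk : j ≤ k), f j k hjk ⁻¹' (f i k hik '' U) := by
  ext y
  simp only [mem_preimage, mem_image, mem_iUnion]
  constructor
  · rintro ⟨x, hxU, hxy⟩
    obtain ⟨k, hik, hjk, hk⟩ := (directLimitMk_eq_iff f).1 hxy
    exact ⟨k, hik, hjk, x, hxU, hk⟩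
  · rintro ⟨k, hik, hjk, x, hxU, hk⟩
    exact ⟨x, hxU, (directLimitMk_eq_iff f).2 ⟨k, hik, hjk, hk⟩⟩

/-- **The canonical maps of a direct limit along open maps are open.**
[cite: BourbakiGT1, Ch. I §2 no. 4] -/
theorem isOpenMap_directLimitMk (hopen : ∀ i j h, IsOpenMap (f i j h)) (i : ι) :
    IsOpenMap fun x : F i ↦ (⟦⟨i, x⟩⟧ : DirectLimit F f) := by
  intro U hU
  rw [← (isQuotientMap_quotient_mk' (s := DirectLimit.setoid f)).isOpen_preimage, isOpen_sigma_iff]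
  intro j
  have : Sigma.mk j ⁻¹' (Quotient.mk' (s := DirectLimit.setoid f) ⁻¹'
      ((fun x : F i ↦ (⟦⟨i, x⟩⟧ : DirectLimit F f)) '' U)) =
      (fun y : F j ↦ (⟦⟨j, y⟩⟧ : DirectLimit F f)) ⁻¹'
        ((fun x : F i ↦ (⟦⟨i, x⟩⟧ : DirectLimit F f)) '' U) := rfl
  rw [this, preimage_image_directLimitMk]
  refine isOpen_iUnion fun k ↦ isOpen_iUnion fun hik ↦ isOpen_iUnion fun hjk ↦ ?_
  exact ((hopen i k hik) U hU).preimage (f j k hjk).continuous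

/-- **The canonical maps of a direct limit along open embeddings are open embeddings**
(injectivity is Mathlib's `DirectLimit.mk_injective`). [cite: BourbakiGT1, Ch. I §2 no. 4] -/
theorem isOpenEmbedding_directLimitMk (hinj : ∀ i j h, Injective (f i j h))
    (hopen : ∀ i j h, IsOpenMap (f i j h)) (i : ι) :
    IsOpenEmbedding fun x : F i ↦ (⟦⟨i, x⟩⟧ : DirectLimit F f) :=
  .of_continuous_injective_isOpenMap (continuous_directLimitMk f i)
    (DirectLimit.mk_injective f hinj i) (isOpenMap_directLimitMk f hopen i)

/-- The image of a piece is open in the limit. [cite: BourbakiGT1, Ch. I §2 no. 4] -/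
theorem isOpen_range_directLimitMk (hopen : ∀ i j h, IsOpenMap (f i j h)) (i : ι) :
    IsOpen (range fun x : F i ↦ (⟦⟨i, x⟩⟧ : DirectLimit F f)) :=
  (isOpenMap_directLimitMk f hopen i).isOpen_range

/-- The images of the pieces increase along the system. [cite: BourbakiGT1, Ch. I §2 no. 4] -/
theorem range_directLimitMk_mono {i j : ι} (hij : i ≤ j) :
    range (fun x : F i ↦ (⟦⟨i, x⟩⟧ : DirectLimit F f)) ⊆
      range fun y : F j ↦ (⟦⟨j, y⟩⟧ : DirectLimit F f) := by
  rintro _ ⟨x, rfl⟩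
  exact ⟨f i j hij x, DirectLimit.mk_apply (f := f) i j x hij⟩

/-- The images of the pieces cover the limit. [cite: BourbakiGT1, Ch. I §2 no. 4] -/
theorem iUnion_range_directLimitMk :
    ⋃ i, range (fun x : F i ↦ (⟦⟨i, x⟩⟧ : DirectLimit F f)) = univ := by
  refine eq_univ_of_forall fun z ↦ ?_
  obtain ⟨i, x, rfl⟩ := DirectLimit.exists_eq_mk f z
  exact mem_iUnion.2 ⟨i, x, rfl⟩

/-- **Every compact subset of the limit lies in the image of one piece** (finite subcover of the
open cover by the images, and directedness). [cite: BourbakiGT1, Ch. I §9] -/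
theorem exists_subset_range_directLimitMk_of_isCompact [Nonempty ι]
    (hopen : ∀ i j h, IsOpenMap (f i j h)) {K : Set (DirectLimit F f)} (hK : IsCompact K) :
    ∃ i, K ⊆ range fun x : F i ↦ (⟦⟨i, x⟩⟧ : DirectLimit F f) := by
  obtain ⟨t, ht⟩ := hK.elim_finite_subcover
    (fun i ↦ range fun x : F i ↦ (⟦⟨i, x⟩⟧ : DirectLimit F f))
    (fun i ↦ isOpen_range_directLimitMk f hopen i)
    (by rw [iUnion_range_directLimitMk]; exact subset_univ K)
  obtain ⟨k, hk⟩ := t.exists_le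
  exact ⟨k, ht.trans (iUnion₂_subset fun i hi ↦ range_directLimitMk_mono f (hk i hi))⟩

/-- **A direct limit of Hausdorff spaces along open embeddings is Hausdorff**: two points lie in a
common piece, are separated there, and the canonical map is an open embedding.
[cite: BourbakiGT1, Ch. I §8] -/
theorem t2Space_directLimit [∀ i, T2Space (F i)] (hinj : ∀ i j h, Injective (f i j h))
    (hopen : ∀ i j h, IsOpenMap (f i j h)) : T2Space (DirectLimit F f) := by
  refine (t2Space_iff _).2 fun z w hzw ↦ ?_
  obtain ⟨i, x, y, rfl, rfl⟩ := DirectLimit.exists_eq_mk₂ f z w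
  have hxy : x ≠ y := fun h ↦ hzw (h ▸ rfl)
  obtain ⟨U, V, hU, hV, hxU, hyV, hUV⟩ := t2_separation hxy
  refine ⟨_, _, isOpenMap_directLimitMk f hopen i U hU, isOpenMap_directLimitMk f hopen i V hV,
    mem_image_of_mem _ hxU, mem_image_of_mem _ hyV, ?_⟩
  exact (disjoint_image_iff (DirectLimit.mk_injective f hinj i)).2 hUV

/-- A direct limit of preconnected spaces over a directed order is preconnected (any two points lie
in the image of a common piece). [cite: BourbakiGT1, Ch. I §11] -/
theorem preconnectedSpace_directLimit [∀ i, PreconnectedSpace (F i)] :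
    PreconnectedSpace (DirectLimit F f) := by
  refine ⟨isPreconnected_of_forall_pair fun z _ w _ ↦ ?_⟩
  obtain ⟨i, x, y, rfl, rfl⟩ := DirectLimit.exists_eq_mk₂ f z w
  exact ⟨range fun x : F i ↦ (⟦⟨i, x⟩⟧ : DirectLimit F f), subset_univ _, ⟨x, rfl⟩, ⟨y, rfl⟩,
    isPreconnected_range (continuous_directLimitMk f i)⟩

/-- A direct limit of connected spaces over a nonempty directed order is connected.
[cite: BourbakiGT1, Ch. I §11] -/
theorem connectedSpace_directLimit [Nonempty ι] [∀ i, ConnectedSpace (F i)] :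
    ConnectedSpace (DirectLimit F f) := by
  haveI := preconnectedSpace_directLimit f
  obtain ⟨i⟩ := ‹Nonempty ι›
  obtain ⟨x⟩ := (inferInstance : Nonempty (F i))
  exact ⟨⟨(⟦⟨i, x⟩⟧ : DirectLimit F f)⟩⟩

/-- A direct limit of weakly locally compact spaces along open embeddings is weakly locally
compact. [cite: BourbakiGT1, Ch. I §9 no. 7] -/
theorem weaklyLocallyCompactSpace_directLimit [∀ i, WeaklyLocallyCompactSpace (F i)]
    (hinj : ∀ i j h, Injective (f i j h)) (hopen : ∀ i j h, IsOpenMap (f i j h)) :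
    WeaklyLocallyCompactSpace (DirectLimit F f) := by
  refine ⟨fun z ↦ ?_⟩
  obtain ⟨i, x, rfl⟩ := DirectLimit.exists_eq_mk f z
  obtain ⟨K, hK, hKx⟩ := exists_compact_mem_nhds x
  exact ⟨_, hK.image (continuous_directLimitMk f i),
    (isOpenEmbedding_directLimitMk f hinj hopen i).isOpenMap.image_mem_nhds hKx⟩

/-- **Second countability**: if countably many pieces are cofinal and every piece is second
countable, a direct limit along open embeddings is second countable (a countable open cover by
second countable subspaces, `secondCountableTopology_of_countable_cover`).
[cite: BourbakiGT1, Ch. IX §2 no. 8] -/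
theorem secondCountableTopology_directLimit_of_cofinal [∀ i, SecondCountableTopology (F i)]
    (hinj : ∀ i j h, Injective (f i j h)) (hopen : ∀ i j h, IsOpenMap (f i j h))
    {s : Set ι} (hs : s.Countable) (hcof : ∀ i, ∃ j ∈ s, i ≤ j) :
    SecondCountableTopology (DirectLimit F f) := by
  haveI : Countable s := hs.to_subtype
  haveI : ∀ j : s, SecondCountableTopology
      (range fun x : F (j : ι) ↦ (⟦⟨(j : ι), x⟩⟧ : DirectLimit F f)) := fun j ↦
    (isOpenEmbedding_directLimitMk f hinj hopen (j : ι)).isEmbedding.toHomeomorph.symm.secondCountableTopology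
  refine secondCountableTopology_of_countable_cover
    (U := fun j : s ↦ range fun x : F (j : ι) ↦ (⟦⟨(j : ι), x⟩⟧ : DirectLimit F f))
    (fun j ↦ isOpen_range_directLimitMk f hopen (j : ι)) ?_
  refine eq_univ_of_forall fun z ↦ ?_
  obtain ⟨i, x, rfl⟩ := DirectLimit.exists_eq_mk f z
  obtain ⟨j, hjs, hij⟩ := hcof i
  exact mem_iUnion.2 ⟨⟨j, hjs⟩, range_directLimitMk_mono f hij ⟨x, rfl⟩⟩

end Literature.Topology
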